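import Literature.MathematicalPhysics.QuantumFieldTheory.Balaban1983to89.B8DentedCubeMemberTorusClasses
import Literature.MathematicalPhysics.QuantumFieldTheory.Balaban1983to89.B8Eq192DentedCubeMemberOfReal1G
import Literature.MathematicalPhysics.QuantumFieldTheory.Balaban1983to89.B8Eq348CubeMemberKKT

/-!
# `Balaban1983to89.B8DentedCubeMemberBoxTowers` — [Balaban1985BackgroundPropagators] (3.48) ∕ [Balaban1985RegularSpaces] (1.91) ON THE DENTED CUBE MEMBER of
# [Balaban1985Variational] (148)–(150): THE TOWER DICTIONARY OF THE DENTED BOX MEMBER (`levD`) AND THE LETTERS `Qᵀ`, `K` OF THE p6 FLAT CONSUMER ON THE DENTED CELLS —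
# dented twins of dag-n05-c's G0 `B8Eq348CubeMemberKKT` §§3–5, G1 `B8CubeMemberBoxDomainsL0.tower_iff_levL0_eq`, F12 `B8Eq348CubeMemberFlatMatrixNorm.flatKernel_rowAbs_le`

statement-level skeleton of published theorems with citation tags; proofs where landed; nothing here is a claim about the
Yang–Mills mass gap

`[Balaban1985BackgroundPropagators]` ([4], CMP **99** (1985) 389–434) Theorem 3.2 (3.48) p. 398, (3.22)–(3.25) p. 394; `[Balaban1985RegularSpaces]` ("B8" = [6], CMP
**99** (1985) 75–102) (1.91)–(1.92) p. 91, (1.131) p. 99, p. 98, (1.3)–(1.6) p. 77, (1.31) p. 81; `[Balaban1984PropagatorsII]` ("B6", CMP **96** (1984) 223–250)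
(2.1)–(2.4) p. 224, (2.13)–(2.14) p. 225, (2.45) p. 231; `[Balaban1985Variational]` ("[15]", CMP **102** (1985) 277–309) (148)–(152) p. 301.
PDF held: `paper:balaban1985-cmp99-regular-spaces-gauge-fixing`, `paper:balaban1985-cmp102-variational-background`.

CITATION HEADER (lean-in-tree rule).  Cell `pub-ymgap` (YM Track A, HUMAN RULING D-0062), DAG node N05 = [B8], seat `pub-ymgap-dag-n05-e` (g32; FAN-OUT §N05 row s3b,
Proposition-6 lane; piece (d2-e) of the (β) road — the SECOND dented transfer (the 𝒢-bound, [4] Thm 3.2): g31 HANDOFF «Next 1 (ii)», dag-n05-c STANDING GO I.42366, this seat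
INTENT I.43465).  WHY THIS FILE.  dag-n05-c's `B8Thm32GBoundCubeMemberHolds.gBoundCubeMemberPrinted_of_one_le` proves the 𝒢-bound ([4] Thm 3.2 (3.48), row-summed) for the
p6 flat consumer's Dirichlet matrices on the PURE cube member by EXACT TRANSFER to p21's hypothesis-free `B6Prop23MultiLevelBoxL0.prop23_multiLevelBox` on the level-`0` box
member `cubeDomainsL0` (level function `levL0`); the (β) road's crown needs the same bound on the DENTED member (named fact `GBoundDentedCubeMemberPrinted`, p661669).  The
dented box member is FREE: r03's `TDomains.toDomains` of this seat's torus member `B8CubeMemberTorusDomainsDented.cubeTDomainsDented … (boxP …) …` (level function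
`levD`).  THIS FILE re-reads, on NODE 00's dented datum `c : CubeB8D` (tower `c.sq`, cells `c.lamS`), the lattice∕letter lemmas the transfer consumes: §1 the tower
dictionary `levD(x + t) = j ⇔ Bʲ(x) ∈ Λ′_j` (via g31's `cover_dented` ∕ `not_mem_sq_of_tower_lt` and file 1's `le_levD_iff`-readings), §2 the letters `Qᵀ`, `K` of the consumer
on the dented cells (one-term columns by `towers_disjoint_dented`, the support of a deep row, the row-sum bound via `cover_dented`, the wall rows by locality).

WHAT THIS FILE PROVES (kernel-checked; `L = ℓ + 1 ≥ 2`; `c : Node00.CubeB8D (d+1) (ℓ+1) K Ω`; the consumer's letters `S ↔ c.sq 0`, `B ↔ {(j, y) : j ≤ k, y ∈ c.lamS j}`, `K`, `Q`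
as displayed in `GBoundDentedCubeMemberPrinted`).
* §1 `mem_lamS_zero_iff` (`Λ′₀ = □₀ ∖ Ω′₁`), `mem_cube_of_tower`, `mem_sq_of_tower` (`Bʲ(x) ∈ Λ′_j ⟹ x ∈ Ω′_j`), `towerBlock_subset_sq_zero`, `tower_level_zero_of_not_mem`,
  `levD_eq_of_tower`, ★ `tower_iff_levD_eq` (`Bʲ(x) ∈ Λ′_j ⇔ levD(x + t) = j`, `x ∈ □₀`, `j ≤ k`), `levD_shift_pos_iff` (`0 < levD(x + t) ⇔ x ∈ Ω′₁`).
* §2 `Qt_mulVec_eq` (a column of `Qᵀ` has one term), `good_of_K_ne_zero` (the support of a deep row has its neighbours in `□₀`), `K_support_of_not_mem`,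
  ★ `flatKernel_rowAbs_le` (`Σ_z |K(x,z)| ≤ (4(d+1) + a_max)η⁻²`), ★ `wall_rows_bound` (`|(T(Tu))(x)| ≤ ((4(d+1) + a_max)η⁻²)²·s` near the Dirichlet wall).

HONEST SCOPE ∕ NOT CLAIMED.  Lattice bookkeeping and the consumer's elementary letter identities ∕ row sums on the dented cells — token twins of dag-n05-c's PURE lemmas;
no estimate of [4]∕[6] beyond the elementary row sum; count-neutral; N05 ∕ N07 NOT discharged; one finite `T⁴` programme at fixed `ε`, Bałaban as printed; nothing
continuum ∕ ℝ⁴ ∕ OS ∕ mass-gap ∕ Clay.  No `sorry`, no `def`, no `instance`, no `notation`.  Unit `pub-ymgap-dag-n05-e` (g32), 2026-08-28.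

RELATED IN THE TREE, NOT DUPLICATED (`rg -l 'DentedCubeMemberBox' Balaban1983to89` = 0, 2026-08-28T22:10Z): G0 `B8Eq348CubeMemberKKT` ∕ F12 `B8Eq348CubeMemberFlatMatrixNorm` ∕
G1 `B8CubeMemberBoxDomainsL0` (dag-n05-c; the PURE models — their generic lemmas `K_support`, `abs_mulVec_le_rowAbs`, `near_wall_dichotomy`, `mem_cube_zero_of_near_cube_one`,
`abs_row_le`, `card_filter_block_le` USED by name), `B8Eq192DentedCubeMemberOfReal1G` §1 (g31; `cover_dented`, `towerBlock_subset_sq`, `not_mem_sq_of_tower_lt` USED),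
`B8Eq191FlatLettersDentedCubeMember.towers_disjoint_dented` (g31; USED), `B8DentedCubeMemberTorusClasses` (g32; USED), `B8CubeMemberTorusDomainsDented.levD` (g31; USED).
-/
noncomputable section

namespace Literature.MathematicalPhysics.QuantumFieldTheory.Balaban1983to89.B8DentedCubeMemberBoxTowers

open scoped Matrix
open B7Prop1Explicit (e)
open B7Prop1Local (InBox)
open B8Ineq132 (Under)
open B8Eq131Cubes (cube sqLo sqHi inLo inHi cube_anti)
open B8Eq131CubesAdmissible (cubeFam cubeFam_false_of_le cubeFam_false_zero smul_mem_cube_iff)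
open B8Eq191FlatLettersCubeMember (under_iff_blockMap_eq)
open B8Eq191FlatLettersDentedCubeMember (towers_disjoint_dented)
open B8Eq192DentedCubeMemberOfReal1G (cover_dented towerBlock_subset_sq not_mem_sq_of_tower_lt)
open B8DentedCubeMemberZd (lamST_top inBox_sq_of_mem_lamS)
open B8Eq348CubeMemberKKT (K_support abs_mulVec_le_rowAbs abs_e_apply_le mem_cube_zero_of_near_cube_one)
open B8Eq198CubeMemberOfReal12 (card_filter_block_le)
open B8Eq1101CubeMemberParametrixIdentity (abs_row_le)
open B8CubeMemberBoxDomains (shift)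
open B8CubeMemberTorusDomainsDented (levD levD_le le_levD_iff levD_pos_iff)
open B8CubeMemberTorusClasses (mem_cube_iff_blockMap)
open B8DentedCubeMemberTorusClasses (mem_sq_iff_blockMap mem_sq_one_iff not_mem_sq_one_of_mem_lamS_zero)
open Node00 (CubeB8D)
open Literature.MathematicalPhysics.QuantumLattice (blockMap)

variable {d : ℕ}

/-! ## §1 The tower dictionary of the dented member -/

section Towers

variable {ℓ K : ℕ} {Ω : ℕ → Set (Fin (d + 1) → ℤ)} (c : CubeB8D (d + 1) (ℓ + 1) K Ω)

/-- **`Λ′₀ = □₀ ∖ Ω′₁`**: the level-`0` cells of the dented tower are the sites of `□₀` off `Ω′₁` (`= □₁` for `k ≥ 2`, `= □₁ ∩ Ω₁` for `k = 1`).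
[cite: Balaban1985RegularSpaces, (1.131) p.99 («Λ′₀ = T ∖ □₁», here cut to `□₀`), (1.5) p.77; Balaban1985Variational, (148)–(150) p.301] -/
theorem mem_lamS_zero_iff (z : Fin (d + 1) → ℤ) : z ∈ c.lamS 0 ↔ z ∈ cube (ℓ + 1) c.a c.M c.ρ c.k 0 ∧ z ∉ c.sq 1 := by
  have hk := c.one_le_k
  have h0 : z ∈ cube (ℓ + 1) c.a c.M c.ρ c.k 0 ↔ InBox (sqLo (ℓ + 1) c.a c.ρ c.k 0) (sqHi (ℓ + 1) c.a c.M c.ρ c.k 0) z := by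
    have h := smul_mem_cube_iff (Nat.succ_pos ℓ) c.a c.M c.ρ c.k 0 z
    rwa [pow_zero, one_smul] at h
  rw [h0, mem_sq_one_iff c z]
  simp only [Node00.CubeB8D.lamS, if_pos (Nat.zero_le c.k), Set.mem_setOf_eq]
  constructor
  · rintro ⟨h1, -, h3⟩
    exact ⟨h1, h3 (by omega)⟩
  · rintro ⟨h1, h3⟩
    exact ⟨h1, fun h => absurd h (by omega), fun _ => h3⟩

/-- A fine site whose `Lʲ`-block is a dented cell lies in `□_j`. [cite: Balaban1985RegularSpaces, (1.5)–(1.6) p.77, (1.131) p.99; Balaban1985Variational, (148) p.301] -/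
theorem mem_cube_of_tower {j : ℕ} {z : Fin (d + 1) → ℤ} (hzj : blockMap ((ℓ + 1) ^ j) z ∈ c.lamS j) : z ∈ cube (ℓ + 1) c.a c.M c.ρ c.k j :=
  (mem_cube_iff_blockMap (Nat.succ_pos ℓ) z).2 (inBox_sq_of_mem_lamS c hzj)

/-- **`Bʲ(x) ∈ Λ′_j ⟹ x ∈ Ω′_j`** (`j ≤ k`): the block of a dented cell lies in the dented domain — at the top by the `Ω_k` clause of the cell («Bᵏ(Λ′_k) ⊂ Ω′_k»).
[cite: Balaban1985RegularSpaces, (1.5)–(1.6) p.77; Balaban1985Variational, (148)–(150) p.301] -/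
theorem mem_sq_of_tower {j : ℕ} (hjk : j ≤ c.k) {x : Fin (d + 1) → ℤ} (hxj : blockMap ((ℓ + 1) ^ j) x ∈ c.lamS j) : x ∈ c.sq j := by
  rw [mem_sq_iff_blockMap c hjk]
  simp only [Node00.CubeB8D.lamS, if_pos hjk, Set.mem_setOf_eq] at hxj
  exact ⟨hxj.1, hxj.2.1⟩

/-- A fine site under a dented cell of level `j ≤ k` lies in `Ω′₀ = □₀` (g31's `towerBlock_subset_sq` at the top truncation, in `c.lamS` letters).
[cite: Balaban1985RegularSpaces, (1.131) p.99, (1.5) p.77; Balaban1985Variational, (148)–(150) p.301] -/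
theorem towerBlock_subset_sq_zero {j : ℕ} (hjk : j ≤ c.k) {x z : Fin (d + 1) → ℤ} (hxj : blockMap ((ℓ + 1) ^ j) x ∈ c.lamS j)
    (hz : blockMap ((ℓ + 1) ^ j) z = blockMap ((ℓ + 1) ^ j) x) : z ∈ c.sq 0 :=
  towerBlock_subset_sq c (Nat.succ_pos ℓ) le_rfl hjk (by rw [lamST_top]; exact hxj) hz

/-- A site outside `□₁` is in no dented cell block of level `≥ 1`: its only tower is the level-`0` one. [cite: Balaban1985RegularSpaces, (1.5)–(1.6) p.77, (1.131) p.99; Balaban1985Variational, (150) p.301] -/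
theorem tower_level_zero_of_not_mem {j : ℕ} (hjk : j ≤ c.k) {x : Fin (d + 1) → ℤ} (hx1 : x ∉ cube (ℓ + 1) c.a c.M c.ρ c.k 1)
    (hxj : blockMap ((ℓ + 1) ^ j) x ∈ c.lamS j) : j = 0 := by
  by_contra hj0
  have hjpos : 1 ≤ j := Nat.pos_of_ne_zero hj0
  exact hx1 (cube_anti hjpos hjk (mem_cube_of_tower c hxj))

/-- **`Bʲ(x) ∈ Λ′_j ⟹ levD(x + t) = j`** (`j ≤ k`): `x ∈ Ω′_j` (`mem_sq_of_tower`) and, for `j < k`, `x ∉ Ω′_{j+1}` (g31's dented exclusion `not_mem_sq_of_tower_lt`).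
[cite: Balaban1984PropagatorsII, (2.3)–(2.4) p.224; Balaban1985RegularSpaces, (1.131) p.99; Balaban1985Variational, (148)–(150) p.301] -/
theorem levD_eq_of_tower {Mh j : ℕ} (hjk : j ≤ c.k) {x : Fin (d + 1) → ℤ} (hxj : blockMap ((ℓ + 1) ^ j) x ∈ c.lamS j) :
    levD Mh c (x + shift ℓ Mh c.a c.ρ c.k c.k) = j := by
  have hL1 : 1 ≤ ℓ + 1 := Nat.succ_pos ℓ
  have hsq : x ∈ c.sq j := mem_sq_of_tower c hjk hxj
  -- lower bound
  have hlow : j ≤ levD Mh c (x + shift ℓ Mh c.a c.ρ c.k c.k) := by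
    rcases Nat.eq_zero_or_pos j with hj0 | hj1
    · rw [hj0]; exact Nat.zero_le _
    · exact (le_levD_iff Mh c hj1 hjk _).2 (by rw [add_sub_cancel_right]; exact hsq)
  -- upper bound
  rcases lt_or_eq_of_le hjk with hlt | heq
  · have hnot : ¬ j + 1 ≤ levD Mh c (x + shift ℓ Mh c.a c.ρ c.k c.k) := by
      intro h
      have hx1 : x ∈ c.sq (j + 1) := by
        have := (le_levD_iff Mh c (Nat.succ_pos j) hlt _).1 h
        rwa [add_sub_cancel_right] at this
      exact not_mem_sq_of_tower_lt c hL1 le_rfl hlt (Nat.lt_succ_self j) hlt (by rw [lamST_top]; exact hxj) hx1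
    omega
  · have := levD_le Mh c (x + shift ℓ Mh c.a c.ρ c.k c.k)
    omega

/-- ★ **THE TOWER DICTIONARY OF THE DENTED MEMBER**: for `x ∈ □₀` and `j ≤ k`, `Bʲ(x) ∈ Λ′_j ⇔ levD(x + t) = j` — the dented twin of G1's `tower_iff_levL0_eq`; the converse
by g31's dented cover `cover_dented` (every site of `□₀` lies under SOME dented cell) and the forward direction at that cell.
[cite: Balaban1984PropagatorsII, (2.3)–(2.4) p.224, (2.45) p.231; Balaban1985RegularSpaces, (1.131) p.99, (1.5)–(1.6) p.77; Balaban1985Variational, (148)–(150) p.301] -/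
theorem tower_iff_levD_eq {Mh j : ℕ} (hjk : j ≤ c.k) {x : Fin (d + 1) → ℤ} (hx0 : x ∈ cube (ℓ + 1) c.a c.M c.ρ c.k 0) :
    blockMap ((ℓ + 1) ^ j) x ∈ c.lamS j ↔ levD Mh c (x + shift ℓ Mh c.a c.ρ c.k c.k) = j := by
  refine ⟨levD_eq_of_tower c hjk, fun h => ?_⟩
  obtain ⟨J, hJk, hxJ⟩ := cover_dented c (Nat.succ_pos ℓ) le_rfl x (by rw [c.sq_zero]; exact hx0)
  rw [lamST_top] at hxJ
  have hJ := levD_eq_of_tower c (Mh := Mh) hJk hxJ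
  rw [h] at hJ
  subst hJ
  exact hxJ

/-- `0 < levD(x + t) ⇔ x ∈ Ω′₁`. [cite: Balaban1984PropagatorsII, (2.3)–(2.4) p.224 («Λ₀ = Ω₁ᶜ»); Balaban1985Variational, (150) p.301] -/
theorem levD_shift_pos_iff {Mh : ℕ} (x : Fin (d + 1) → ℤ) : 0 < levD Mh c (x + shift ℓ Mh c.a c.ρ c.k c.k) ↔ x ∈ c.sq 1 := by
  rw [levD_pos_iff Mh c, add_sub_cancel_right]

end Towers

/-! ## §2 The consumer's letters `Qᵀ`, `K` on the dented cells -/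

section Letters

variable {ℓ K' : ℕ} {Ω : ℕ → Set (Fin (d + 1) → ℤ)} (c : CubeB8D (d + 1) (ℓ + 1) K' Ω)

/-- **A COLUMN OF `Qᵀ` HAS ONE TERM**: for a site `z` in the tower `p` (`Bʲ(z) = y_p`), `(Qᵀg)(z) = L^{−(d+1)j}·g(p)` — the towers of the dented member are disjoint
(g31's `towers_disjoint_dented`). [cite: Balaban1985RegularSpaces, (1.5)–(1.6) p.77, (1.31) p.81, (1.91) p.91; Balaban1985Variational, (148)–(150) p.301] -/
theorem Qt_mulVec_eq (S : Finset (Fin (d + 1) → ℤ)) (hS : ∀ x, x ∈ S ↔ x ∈ c.sq 0)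
    (B : Finset (ℕ × (Fin (d + 1) → ℤ))) (hB : ∀ p, p ∈ B ↔ p.1 ≤ c.k ∧ p.2 ∈ c.lamS p.1)
    (Q : Matrix ↥B ↥S ℝ) (hQ : Q = Matrix.of (fun (p : ↥B) (z : ↥S) =>
      if blockMap ((ℓ + 1) ^ p.1.1) z.1 = p.1.2 then (((((ℓ + 1 : ℕ) : ℝ)) ^ (d + 1))⁻¹) ^ p.1.1 else 0))
    (g : ↥B → ℝ) (z : ↥S) (p : ↥B) (hzp : blockMap ((ℓ + 1) ^ p.1.1) z.1 = p.1.2) :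
    (Qᵀ *ᵥ g) z = (((((ℓ + 1 : ℕ) : ℝ)) ^ (d + 1))⁻¹) ^ p.1.1 * g p := by
  have hdisj := towers_disjoint_dented c (Nat.succ_pos ℓ) le_rfl
  rw [lamST_top] at hdisj
  rw [Matrix.mulVec, dotProduct, Finset.sum_eq_single p]
  · rw [Matrix.transpose_apply, hQ, Matrix.of_apply, if_pos hzp]
  · intro p' _ hp'
    rw [Matrix.transpose_apply, hQ, Matrix.of_apply, if_neg, zero_mul]
    intro hc
    obtain ⟨hp1, hp2⟩ := (hB p.1).mp p.2
    obtain ⟨hp1', hp2'⟩ := (hB p'.1).mp p'.2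
    obtain ⟨hjj, hyy⟩ := hdisj p'.1.1 hp1' p.1.1 hp1 p'.1.2 hp2' p.1.2 hp2 z.1 ((hS z.1).mp z.2) hc hzp
    exact hp' (Subtype.ext (Prod.ext hjj hyy))
  · intro h; exact absurd (Finset.mem_univ _) h

open Classical in
/-- **EVERY SITE IN THE SUPPORT OF A DEEP ROW HAS ITS NEIGHBOURS IN `□₀`**: if the `2`-ball of `x` lies in `□₀` then every `z` with `K(x,z) ≠ 0` (restriction sets = the dented
cells) lies in `□₀` together with all its lattice neighbours (`ρ ≥ L ≥ 1`). [cite: Balaban1985RegularSpaces, (1.91) p.91, (1.131) p.99, p.98; Balaban1985Variational, (148)–(151) p.301] -/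
theorem good_of_K_ne_zero {η : ℝ} (w : ℕ → ℝ) (K : (Fin (d + 1) → ℤ) → (Fin (d + 1) → ℤ) → ℝ)
    (hK : ∀ x z, K x z = ((η ^ 2)⁻¹ * ∑ μ : Fin (d + 1), ((2 : ℝ) * (if z = x then (1 : ℝ) else 0) - (if z = x + e μ then (1 : ℝ) else 0)
        - (if z = x - e μ then (1 : ℝ) else 0))) +
        (∑ j ∈ Finset.range (c.k + 1), (if blockMap ((ℓ + 1) ^ j) x ∈ c.lamS j ∧ blockMap ((ℓ + 1) ^ j) z = blockMap ((ℓ + 1) ^ j) x then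
          w j * (((((ℓ + 1 : ℕ) : ℝ) ^ (d + 1))⁻¹) ^ j) ^ 2 else 0)))
    {x z : Fin (d + 1) → ℤ} (hx : ∀ τ : Fin (d + 1) → ℤ, (∀ i, |τ i| ≤ 2) → x + τ ∈ cube (ℓ + 1) c.a c.M c.ρ c.k 0) (h : K x z ≠ 0) :
    z ∈ cube (ℓ + 1) c.a c.M c.ρ c.k 0 ∧ ∀ μ : Fin (d + 1), z + e μ ∈ cube (ℓ + 1) c.a c.M c.ρ c.k 0 ∧ z - e μ ∈ cube (ℓ + 1) c.a c.M c.ρ c.k 0 := by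
  have hk : 1 ≤ c.k := c.one_le_k
  have hρ1 : 1 ≤ c.ρ := le_trans (Nat.succ_pos ℓ) c.L_le_ρ
  -- a site within `|·|_∞ ≤ 1` of `x` is good
  have hnear : ∀ σ : Fin (d + 1) → ℤ, (∀ i, |σ i| ≤ 1) →
      x + σ ∈ cube (ℓ + 1) c.a c.M c.ρ c.k 0 ∧ ∀ μ : Fin (d + 1), x + σ + e μ ∈ cube (ℓ + 1) c.a c.M c.ρ c.k 0 ∧ x + σ - e μ ∈ cube (ℓ + 1) c.a c.M c.ρ c.k 0 := by
    intro σ hσ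
    refine ⟨hx σ (fun i => (hσ i).trans (by norm_num)), fun μ => ⟨?_, ?_⟩⟩
    · rw [add_assoc]
      refine hx _ fun i => ?_
      simp only [Pi.add_apply]
      exact (abs_add_le _ _).trans (by linarith [hσ i, abs_e_apply_le μ i])
    · rw [add_sub_assoc]
      refine hx _ fun i => ?_
      simp only [Pi.sub_apply]
      exact (abs_sub _ _).trans (by linarith [hσ i, abs_e_apply_le μ i])
  rcases K_support (ℓ + 1) c.k c.lamS w K (by simpa using hK) h with hzx | ⟨μ, hμ | hμ⟩ | ⟨j, hjn, hxj, hzj⟩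
  · have := hnear 0 (fun i => by simp)
    rw [add_zero] at this; rw [hzx]; exact this
  · have := hnear (e μ) (fun i => abs_e_apply_le μ i)
    rw [hμ]; exact this
  · have := hnear (-e μ) (fun i => by rw [Pi.neg_apply, abs_neg]; exact abs_e_apply_le μ i)
    rw [← sub_eq_add_neg] at this
    rw [hμ]; exact this
  · rcases Nat.eq_zero_or_pos j with hj0 | hjpos
    · -- level `0`: the block of `x` is `{x}`
      subst hj0
      have h0 : ∀ y : Fin (d + 1) → ℤ, blockMap ((ℓ + 1) ^ 0) y = y := fun y => by funext i; simp [blockMap]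
      rw [h0, h0] at hzj
      have := hnear 0 (fun i => by simp)
      rw [add_zero] at this; rw [hzj]; exact this
    · -- level `j ≥ 1`: the block lies in `□_j ⊆ □₁`, a unit step stays in `□₀`
      have hzcube : z ∈ cube (ℓ + 1) c.a c.M c.ρ c.k j := mem_cube_of_tower c (by rw [hzj]; exact hxj)
      have hz1 : z ∈ cube (ℓ + 1) c.a c.M c.ρ c.k 1 := cube_anti hjpos hjn hzcube
      refine ⟨?_, fun μ => ⟨?_, ?_⟩⟩
      · have := mem_cube_zero_of_near_cube_one c.a c.M hk hz1 (r := 1) hρ1 (τ := 0) (fun i => by simp)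
        rwa [add_zero] at this
      · exact mem_cube_zero_of_near_cube_one c.a c.M hk hz1 hρ1 (fun i => by exact_mod_cast abs_e_apply_le μ i)
      · rw [sub_eq_add_neg]
        exact mem_cube_zero_of_near_cube_one c.a c.M hk hz1 hρ1 (fun i => by
          rw [Pi.neg_apply, abs_neg]; exact_mod_cast abs_e_apply_le μ i)

open Classical in
/-- The support of a row through a site off `□₁` is the site and its lattice neighbours. [cite: Balaban1985RegularSpaces, (1.91) p.91, (1.131) p.99; Balaban1985Variational, (150) p.301] -/
theorem K_support_of_not_mem {η : ℝ} (w : ℕ → ℝ) (K : (Fin (d + 1) → ℤ) → (Fin (d + 1) → ℤ) → ℝ)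
    (hK : ∀ x z, K x z = ((η ^ 2)⁻¹ * ∑ μ : Fin (d + 1), ((2 : ℝ) * (if z = x then (1 : ℝ) else 0) - (if z = x + e μ then (1 : ℝ) else 0)
        - (if z = x - e μ then (1 : ℝ) else 0))) +
        (∑ j ∈ Finset.range (c.k + 1), (if blockMap ((ℓ + 1) ^ j) x ∈ c.lamS j ∧ blockMap ((ℓ + 1) ^ j) z = blockMap ((ℓ + 1) ^ j) x then
          w j * (((((ℓ + 1 : ℕ) : ℝ) ^ (d + 1))⁻¹) ^ j) ^ 2 else 0)))
    {x z : Fin (d + 1) → ℤ} (hx1 : x ∉ cube (ℓ + 1) c.a c.M c.ρ c.k 1) (h : K x z ≠ 0) : ∀ i, |z i - x i| ≤ 1 := by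
  intro i
  rcases K_support (ℓ + 1) c.k c.lamS w K (by simpa using hK) h with hzx | ⟨μ, hμ | hμ⟩ | ⟨j, hjn, hxj, hzj⟩
  · rw [hzx, sub_self, abs_zero]; exact zero_le_one
  · rw [hμ, Pi.add_apply, add_sub_cancel_left]; exact abs_e_apply_le μ i
  · rw [hμ, Pi.sub_apply, sub_sub_cancel_left, abs_neg]; exact abs_e_apply_le μ i
  · have hj0 := tower_level_zero_of_not_mem c hjn hx1 hxj
    subst hj0
    have h0 : ∀ y : Fin (d + 1) → ℤ, blockMap ((ℓ + 1) ^ 0) y = y := fun y => by funext i; simp [blockMap]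
    rw [h0, h0] at hzj
    rw [hzj, sub_self, abs_zero]; exact zero_le_one

open Classical in
/-- ★ **THE ROW SUMS OF `|K|` ON THE DENTED CELLS**: `Σ_{z ∈ □₀} |K(x,z)| ≤ (4(d+1) + a_max)·η⁻²` for `x ∈ □₀` — the stencil contributes `4(d+1)η⁻²`, the ONE tower term
(g31's dented cover + disjointness) at most `w_J·L^{−2(d+1)J}·#block ≤ a_max η⁻²`. The dented twin of F12's `flatKernel_rowAbs_le`.
[cite: Balaban1985BackgroundPropagators, (3.48) p.398; Balaban1985RegularSpaces, (1.91) p.91, (1.131) p.99; Balaban1985Variational, (148)–(151) p.301] -/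
theorem flatKernel_rowAbs_le {η : ℝ} (hη : η ≠ 0) (w : ℕ → ℝ) (hw0 : ∀ j, 0 ≤ w j) {amax : ℝ} (hamax0 : 0 ≤ amax)
    (hamax : ∀ j, j ≤ c.k → w j * η ^ 2 * ((((ℓ + 1 : ℕ) : ℝ)) ^ j) ^ 2 * (((((ℓ + 1 : ℕ) : ℝ) ^ (d + 1)) ^ j))⁻¹ ≤ amax)
    (S : Finset (Fin (d + 1) → ℤ)) (hS : ∀ x, x ∈ S ↔ x ∈ c.sq 0)
    (K : (Fin (d + 1) → ℤ) → (Fin (d + 1) → ℤ) → ℝ)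
    (hK : ∀ x z, K x z = ((η ^ 2)⁻¹ * ∑ μ : Fin (d + 1), ((2 : ℝ) * (if z = x then (1 : ℝ) else 0) - (if z = x + e μ then (1 : ℝ) else 0)
        - (if z = x - e μ then (1 : ℝ) else 0))) +
        (∑ j ∈ Finset.range (c.k + 1), (if blockMap ((ℓ + 1) ^ j) x ∈ c.lamS j ∧ blockMap ((ℓ + 1) ^ j) z = blockMap ((ℓ + 1) ^ j) x then
          w j * (((((ℓ + 1 : ℕ) : ℝ) ^ (d + 1))⁻¹) ^ j) ^ 2 else 0)))
    {x : Fin (d + 1) → ℤ} (hx : x ∈ S) :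
    ∑ z ∈ S, |K x z| ≤ (4 * ((d : ℝ) + 1) + amax) * (η ^ 2)⁻¹ := by
  have hL : 1 ≤ ℓ + 1 := Nat.succ_pos ℓ
  have hL1 : (1 : ℝ) ≤ ((ℓ + 1 : ℕ) : ℝ) := by exact_mod_cast hL
  have hη2 : 0 < η ^ 2 := by positivity
  have hx0 : x ∈ c.sq 0 := (hS x).mp hx
  have hdisj := towers_disjoint_dented c hL le_rfl
  rw [lamST_top] at hdisj
  -- `abs_row_le` against the constant function `1`
  have hrow := abs_row_le (ℓ + 1) c.k c.lamS w hw0 K (by simpa using hK) S x (fun _ => (1 : ℝ)) (fun _ => zero_le_one)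
  simp only [mul_one] at hrow
  -- the stencil part: `Σ_μ (2 + 1 + 1) = 4(d+1)`
  have hsten : (η ^ 2)⁻¹ * ∑ μ : Fin (d + 1), ((2 : ℝ) + 1 + 1) = 4 * ((d : ℝ) + 1) * (η ^ 2)⁻¹ := by
    rw [Finset.sum_const, Finset.card_univ, Fintype.card_fin, nsmul_eq_mul]; push_cast; ring
  -- the tower part collapses to the level `J` of `x` and is `≤ a_max η⁻²`
  obtain ⟨J, hJn, hxJ⟩ := cover_dented c hL le_rfl x hx0
  rw [lamST_top] at hxJ
  have hcollapse : ∑ j' ∈ Finset.range (c.k + 1), (if blockMap ((ℓ + 1) ^ j') x ∈ c.lamS j' then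
        w j' * (((((ℓ + 1 : ℕ) : ℝ) ^ (d + 1))⁻¹) ^ j') ^ 2 * ∑ z ∈ S.filter (fun z => blockMap ((ℓ + 1) ^ j') z = blockMap ((ℓ + 1) ^ j') x), (1 : ℝ) else 0)
      ≤ amax * (η ^ 2)⁻¹ := by
    have h : ∀ j' ∈ Finset.range (c.k + 1), (if blockMap ((ℓ + 1) ^ j') x ∈ c.lamS j' then
        w j' * (((((ℓ + 1 : ℕ) : ℝ) ^ (d + 1))⁻¹) ^ j') ^ 2 * ∑ z ∈ S.filter (fun z => blockMap ((ℓ + 1) ^ j') z = blockMap ((ℓ + 1) ^ j') x), (1 : ℝ) else 0)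
        = if J = j' then w J * (((((ℓ + 1 : ℕ) : ℝ) ^ (d + 1))⁻¹) ^ J) ^ 2 *
            ∑ z ∈ S.filter (fun z => blockMap ((ℓ + 1) ^ J) z = blockMap ((ℓ + 1) ^ J) x), (1 : ℝ) else 0 := by
      intro j' hj'
      have hj'n : j' ≤ c.k := Nat.lt_succ_iff.mp (Finset.mem_range.mp hj')
      by_cases hc : blockMap ((ℓ + 1) ^ j') x ∈ c.lamS j'
      · have hjj : j' = J := (hdisj j' hj'n J hJn _ hc _ hxJ x hx0 rfl rfl).1
        subst hjj; rw [if_pos hc, if_pos rfl]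
      · have hne : J ≠ j' := fun h' => by subst h'; exact hc hxJ
        rw [if_neg hc, if_neg hne]
    rw [Finset.sum_congr rfl h, Finset.sum_ite_eq, if_pos (Finset.mem_range.mpr (Nat.lt_succ_of_le hJn))]
    -- the block has `≤ (L^{d+1})^J` sites
    have hfull : ∀ z, blockMap ((ℓ + 1) ^ J) z = blockMap ((ℓ + 1) ^ J) x → z ∈ S := fun z hz =>
      (hS z).mpr (towerBlock_subset_sq_zero c hJn hxJ hz)
    have hcard := card_filter_block_le hL J S x hfull
    rw [Finset.sum_const, nsmul_eq_mul, mul_one]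
    have hwJ := hamax J hJn
    have hLJ : (1 : ℝ) ≤ ((((ℓ + 1 : ℕ) : ℝ)) ^ J) ^ 2 := one_le_pow₀ (one_le_pow₀ hL1)
    have hpow : 0 < ((((ℓ + 1 : ℕ) : ℝ)) ^ (d + 1)) ^ J := by positivity
    calc w J * (((((ℓ + 1 : ℕ) : ℝ) ^ (d + 1))⁻¹) ^ J) ^ 2 * ((S.filter (fun z => blockMap ((ℓ + 1) ^ J) z = blockMap ((ℓ + 1) ^ J) x)).card : ℝ)
        ≤ w J * (((((ℓ + 1 : ℕ) : ℝ) ^ (d + 1))⁻¹) ^ J) ^ 2 * ((((ℓ + 1 : ℕ) : ℝ)) ^ (d + 1)) ^ J :=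
          mul_le_mul_of_nonneg_left hcard (by have := hw0 J; positivity)
      _ = (w J * η ^ 2 * ((((ℓ + 1 : ℕ) : ℝ)) ^ J) ^ 2 * (((((ℓ + 1 : ℕ) : ℝ) ^ (d + 1)) ^ J))⁻¹) * ((η ^ 2)⁻¹ * (((((ℓ + 1 : ℕ) : ℝ)) ^ J) ^ 2)⁻¹) := by
          rw [inv_pow]; field_simp
      _ ≤ amax * ((η ^ 2)⁻¹ * (((((ℓ + 1 : ℕ) : ℝ)) ^ J) ^ 2)⁻¹) := mul_le_mul_of_nonneg_right hwJ (by positivity)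
      _ ≤ amax * ((η ^ 2)⁻¹ * 1) := by
          refine mul_le_mul_of_nonneg_left (mul_le_mul_of_nonneg_left ?_ (by positivity)) hamax0
          exact inv_le_one_of_one_le₀ hLJ
      _ = amax * (η ^ 2)⁻¹ := by rw [mul_one]
  calc ∑ z ∈ S, |K x z| ≤ _ := hrow
    _ ≤ 4 * ((d : ℝ) + 1) * (η ^ 2)⁻¹ + amax * (η ^ 2)⁻¹ := by rw [← hsten]; exact add_le_add le_rfl hcollapse
    _ = (4 * ((d : ℝ) + 1) + amax) * (η ^ 2)⁻¹ := by ring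

open Classical in
/-- ★ **THE ROWS OF `T²` NEAR THE DIRICHLET WALL, BY LOCALITY** (dented member): if the `2`-ball of `x ∈ □₀` misses `□₁ ⊇ Ω′₁` and `u` agrees with `X` on the level-`0` towers
of that ball, then `|(T(Tu))(x)| ≤ ((4(d+1) + a_max)η⁻²)²·s` for `sup|X| ≤ s` — two row sums of `flatKernel_rowAbs_le`; no inverse is met.
[cite: Balaban1985BackgroundPropagators, Theorem 3.2 (3.48) p.398, (3.22)–(3.25) p.394; Balaban1984PropagatorsII, (2.14) p.225 («(Q′₀λ)(x) = λ(x)»); Balaban1985Variational, (148)–(151) p.301] -/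
theorem wall_rows_bound {η : ℝ} (hη : η ≠ 0) (w : ℕ → ℝ) (hw0 : ∀ j, 0 ≤ w j) {amax : ℝ} (hamax0 : 0 ≤ amax)
    (hamax : ∀ j, j ≤ c.k → w j * η ^ 2 * ((((ℓ + 1 : ℕ) : ℝ)) ^ j) ^ 2 * (((((ℓ + 1 : ℕ) : ℝ) ^ (d + 1)) ^ j))⁻¹ ≤ amax)
    (S : Finset (Fin (d + 1) → ℤ)) (hS : ∀ x, x ∈ S ↔ x ∈ c.sq 0)
    (B : Finset (ℕ × (Fin (d + 1) → ℤ))) (hB : ∀ p, p ∈ B ↔ p.1 ≤ c.k ∧ p.2 ∈ c.lamS p.1)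
    (K : (Fin (d + 1) → ℤ) → (Fin (d + 1) → ℤ) → ℝ)
    (hK : ∀ x z, K x z = ((η ^ 2)⁻¹ * ∑ μ : Fin (d + 1), ((2 : ℝ) * (if z = x then (1 : ℝ) else 0) - (if z = x + e μ then (1 : ℝ) else 0)
        - (if z = x - e μ then (1 : ℝ) else 0))) +
        (∑ j ∈ Finset.range (c.k + 1), (if blockMap ((ℓ + 1) ^ j) x ∈ c.lamS j ∧ blockMap ((ℓ + 1) ^ j) z = blockMap ((ℓ + 1) ^ j) x then
          w j * (((((ℓ + 1 : ℕ) : ℝ) ^ (d + 1))⁻¹) ^ j) ^ 2 else 0)))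
    (T : Matrix ↥S ↥S ℝ) (hT : T = Matrix.of (fun x z : ↥S => K x.1 z.1))
    (u : ↥S → ℝ) (X : ↥B → ℝ) (s : ℝ) (hs : 0 ≤ s) (hXs : ∀ p, |X p| ≤ s)
    (x : ↥S) (hfar : ∀ z : Fin (d + 1) → ℤ, (∀ i, |z i - x.1 i| ≤ 2) → z ∉ cube (ℓ + 1) c.a c.M c.ρ c.k 1)
    (hu0 : ∀ z : ↥S, (∀ i, |z.1 i - x.1 i| ≤ 2) → ∀ hp : ((0 : ℕ), z.1) ∈ B, u z = X ⟨(0, z.1), hp⟩) :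
    |(T *ᵥ (T *ᵥ u)) x| ≤ ((4 * ((d : ℝ) + 1) + amax) * (η ^ 2)⁻¹) ^ 2 * s := by
  have hk := c.one_le_k
  have hrow : ∀ y : ↥S, ∑ z ∈ S, |K y.1 z| ≤ (4 * ((d : ℝ) + 1) + amax) * (η ^ 2)⁻¹ :=
    fun y => flatKernel_rowAbs_le c hη w hw0 hamax0 hamax S hS K hK y.2
  have hC0 : 0 ≤ (4 * ((d : ℝ) + 1) + amax) * (η ^ 2)⁻¹ := by positivity
  -- level-`0` membership of the sites of the ball (off `□₁ ⊇ Ω′₁`)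
  have hmem0 : ∀ z : ↥S, (∀ i, |z.1 i - x.1 i| ≤ 2) → ((0 : ℕ), z.1) ∈ B := by
    intro z hz
    have hz0 : z.1 ∈ cube (ℓ + 1) c.a c.M c.ρ c.k 0 := by rw [← c.sq_zero]; exact (hS z.1).mp z.2
    refine (hB _).mpr ⟨Nat.zero_le _, ?_⟩
    change z.1 ∈ c.lamS 0
    rw [mem_lamS_zero_iff]
    exact ⟨hz0, fun h1 => hfar z.1 hz (c.sq_subset_cube hk h1)⟩
  -- the inner rows: `|(Tu)(z)| ≤ C₀ s` for `z` within `1` of `x`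
  have hinner : ∀ z : ↥S, (∀ i, |z.1 i - x.1 i| ≤ 1) → |(T *ᵥ u) z| ≤ (4 * ((d : ℝ) + 1) + amax) * (η ^ 2)⁻¹ * s := by
    intro z hz
    have hz1 : z.1 ∉ cube (ℓ + 1) c.a c.M c.ρ c.k 1 := hfar z.1 (fun i => (hz i).trans (by norm_num))
    refine (abs_mulVec_le_rowAbs S K T hT u s z fun z' hz' => ?_).trans (mul_le_mul_of_nonneg_right (hrow z) hs)
    have hd1 := K_support_of_not_mem c w K hK hz1 hz'
    have hz'2 : ∀ i, |z'.1 i - x.1 i| ≤ 2 := fun i => by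
      have e1 : z'.1 i - x.1 i = (z'.1 i - z.1 i) + (z.1 i - x.1 i) := by ring
      rw [e1]
      exact (abs_add_le _ _).trans (by linarith [hd1 i, hz i])
    rw [hu0 z' hz'2 (hmem0 z' hz'2)]
    exact hXs _
  -- the outer row
  have hx1 : x.1 ∉ cube (ℓ + 1) c.a c.M c.ρ c.k 1 := hfar x.1 (fun i => by rw [sub_self, abs_zero]; norm_num)
  calc |(T *ᵥ (T *ᵥ u)) x| ≤ (∑ z ∈ S, |K x.1 z|) * ((4 * ((d : ℝ) + 1) + amax) * (η ^ 2)⁻¹ * s) :=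
        abs_mulVec_le_rowAbs S K T hT (T *ᵥ u) _ x fun z hz => hinner z (K_support_of_not_mem c w K hK hx1 hz)
    _ ≤ (4 * ((d : ℝ) + 1) + amax) * (η ^ 2)⁻¹ * ((4 * ((d : ℝ) + 1) + amax) * (η ^ 2)⁻¹ * s) :=
        mul_le_mul_of_nonneg_right (hrow x) (by positivity)
    _ = ((4 * ((d : ℝ) + 1) + amax) * (η ^ 2)⁻¹) ^ 2 * s := by ring

end Letters

end Literature.MathematicalPhysics.QuantumFieldTheory.Balaban1983to89.B8DentedCubeMemberBoxTowers
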